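/-
Copyright (c) 2026. All rights reserved.
Released under Apache 2.0 license as described in the file LICENSE.
-/
import Summits.HodgeConjecture.HodgeConjecture.Theorems.K2LiuLocalSWSpanningCriterion   -- ★ F3b `spanning_criterion`
import Summits.HodgeConjecture.HodgeConjecture.Theorems.K2LiuLocalSWBigCellCoordinate   -- ★ F3c-B4 `exists_bigCell_coordinate` (+ ★ F3c-A/B1/B2/B3)
import Summits.HodgeConjecture.HodgeConjecture.Theorems.K2LiuLocalSWIwasawaCompact      -- ★ F3c-B5 `exists_isCompact_isSiegelDelta_mul`
import Literature.NumberTheory.K2Lit.DoubledUnitaryDegeneratePrincipalSeries             -- ★ `localDegPS`, `IsLocalSiegelSection`, `IsSmooth`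
import HarnessLib

/-!
# Crux `HLiu418`, #42S organ S1, ROAD W, file F3d: LOCAL SIEGEL–WEIL SPANNING FROM A WITNESS (the geometry half of the assembly, by value)

Cell `hodgecm-mathlib`, crux item hLiu418 = `stmt-HodgeConjecture-24832`; squad K2 ∕ K2Liu; prover K2Liu-p06 (g4), the dedicated S1 hand.
THEOREMS ONLY (no `def`, no instance, no notation, no named-fact hypothesis, no `sorry`); lane `--supports stmt-HodgeConjecture-24832 --as helper`.

★ F3b `spanning_criterion` has two kinds of binders: the GROUP GEOMETRY of `H_v = U(T₀ ⊕ −T₀)(F_v)` (`N_Δ` commutative, `H_v = P_Δ K₀` with `K₀` compact, the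
big cell `Ω = P_Δ w_Δ N_Δ` open with a continuous `N_Δ`-coordinate `ν`, contracting Levi scalars) and the WITNESS (`f₀ ∈ U` with a compact-open coordinate profile
`(N₀, N₁ = {B(u) ∈ Λ})` on `w_Δ N_Δ` and a non-zero period sum).  The geometry binders are now ALL theorems of the tree in GR91 local currency (★ F3c-A
`unipDeltaLocal_comm`, ★ F3c-B5 `exists_isCompact_isSiegelDelta_mul`, ★ F3c-B1 `isOpen_bigCell`, ★ F3c-B4 `exists_bigCell_coordinate`, ★ F3c-B3 `exists_contracting`),
so this file DISCHARGES them once and for all: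
* **`mem_of_witness`** — for ANY `ℂ`-subspace `U ≤ (H_v → ℂ)` stable under right translation, ANY left character `χ` non-vanishing on `P_Δ`, and a witness
  `f₀ ∈ U` with the profile of ★ `spanning_criterion` relative to a compact open coordinate box `Λ ∋ 0`: every smooth `f` with `f(p h) = χ(p) f(h)` lies in `U`.
* **`localDegPS_le_of_witness`** — the same with `χ = χ_v(det_Δ)|det_Δ|^{s+n/2}` (★ `localSiegelCharacter`): `I_v(s, χ_v) ≤ U` (★ `localDegPS`).
What is left for organ S1 (#42S, `I_v(½) = R(V⁺) + R(V⁻)`) is the WITNESS in `U = R(V⁺) + R(V⁻)` (W3: big-cell value formula ★ F4a, middle-cell functional F6,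
parity oscillation ∕ ramified sign ∕ split depths F7–F8) and the one-line CM specialisation (`haveI := nonarchimedeanGroup_localPi`, ★ `mem_siegelDeltaLoc_iff_local`,
★ `rightTranslate_mem_localSWImage`, ★ `localSiegelCharacter_ne_zero`).
References: [BernsteinZelevinsky1976] §1.5, §2.2; [Kudla1994] §3; [HarrisKudlaSweet1996] §1 (1.11), (1.15); [KudlaSweet1997] §1.
HONEST LABEL.  Count-neutral helper: `HC_CM` is proved only modulo the 7 printed citations (2 remaining named inputs: hLiu418 = `stmt-HodgeConjecture-24832`,
h413 = `stmt-HodgeConjecture-24833`) until rung 0 closes.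
-/

set_option autoImplicit false
set_option linter.dupNamespace false -- the mandated namespace repeats `HodgeConjecture.HodgeConjecture`

noncomputable section

open NumberField IsDedekindDomain Matrix
open Literature.NumberTheory.Automorphic Literature.NumberTheory.Automorphic.UnitaryGroup
open Literature.NumberTheory.GelbartRogawski1991.AdaptedBlocks
open Literature.NumberTheory.GelbartRogawski1991.UnitaryDualPair.LocalSplitting
open Literature.NumberTheory.K2Lit.LocalSiegelDoubled
open Summit.HodgeConjecture.HodgeConjecture.Cruxes.HLiu418.K2LiuLocalSWSpanningCriterion
open Summit.HodgeConjecture.HodgeConjecture.Cruxes.HLiu418.K2LiuLocalSWBigCellDecomposition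
open Summit.HodgeConjecture.HodgeConjecture.Cruxes.HLiu418.K2LiuLocalSWBigCellTopology
open Summit.HodgeConjecture.HodgeConjecture.Cruxes.HLiu418.K2LiuLocalSWBigCellContraction
open Summit.HodgeConjecture.HodgeConjecture.Cruxes.HLiu418.K2LiuLocalSWBigCellCoordinate
open Summit.HodgeConjecture.HodgeConjecture.Cruxes.HLiu418.K2LiuLocalSWIwasawaCompact

namespace Summit.HodgeConjecture.HodgeConjecture.Cruxes.HLiu418.K2LiuLocalSWSpanningOfWitness

variable (F : Type) [Field F] [NumberField F] (E : Type) [Field E] [NumberField E] [Algebra F E]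
  [Algebra.IsQuadraticExtension F E] (c : E ≃ₐ[F] E)
  {δ : E} (hcδ : c δ = -δ) (hδ : δ ≠ 0) {d : F} (hd : δ * δ = algebraMap F E d)
  (v : HeightOneSpectrum (𝓞 F)) (n : ℕ) {T₀ : Matrix (Fin n) (Fin n) F} (hT₀ : T₀.IsSymm) (hT₀d : IsUnit T₀.det)
  {JD : Matrix (Fin (n + n)) (Fin (n + n)) E} (hJD : JD = (gramD F n T₀).map (algebraMap F E))

include hT₀d in
/-- **LOCAL SPANNING FROM A WITNESS (any right-invariant `U`, any `P_Δ`-character `χ`).**  Let `U ≤ (H_v → ℂ)` be a `ℂ`-subspace stable under right translation,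
`χ : H_v → ℂ` non-vanishing on `P_Δ`, `Λ ∋ 0` a compact open box of `n × n` matrices over `E ⊗ F_v`, `N₁ = {u ∈ N_Δ : B(u) ∈ Λ}` and `N₀` with `N₁/N₀` finite, and
`f₀ ∈ U` a WITNESS: `f₀(p h) = χ(p) f₀(h)`, `f₀ = 0` off the big cell `P_Δ w_Δ N_Δ`, `f₀` right-`N₀`-invariant, `f₀(w_Δ u) = 0` for `u ∈ N_Δ ∖ N₁`, and
`∑_{q ∈ N₁/N₀} f₀(w_Δ q) ≠ 0`.  THEN every smooth `f : H_v → ℂ` with `f(p h) = χ(p) f(h)` lies in `U`.  (★ `spanning_criterion` with all its group-geometry binders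
discharged: ★ `unipDeltaLocal_comm`, ★ `exists_isCompact_isSiegelDelta_mul`, ★ `isOpen_bigCell`, ★ `exists_bigCell_coordinate`, ★ `exists_contracting`.)
[cite: BernsteinZelevinsky1976, §1.5, §2.2] [cite: Kudla1994, §3] [cite: HarrisKudlaSweet1996, §1 (1.11)] [cite: KudlaSweet1997, §1] -/
theorem mem_of_witness [NonarchimedeanGroup (UnitaryGroup.localPi E c (n + n) JD v)]
    {χ : UnitaryGroup.localPi E c (n + n) JD v → ℂ} (hχ : ∀ p, IsSiegelDelta F E c hcδ hδ hd v n hT₀ hJD p → χ p ≠ 0)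
    (U : Submodule ℂ (UnitaryGroup.localPi E c (n + n) JD v → ℂ)) (hU : ∀ G ∈ U, ∀ g : UnitaryGroup.localPi E c (n + n) JD v, (fun h => G (h * g)) ∈ U)
    {Λ : Set (Matrix (Fin n) (Fin n) (LocalRing E v))} (hΛc : IsCompact Λ) (hΛo : IsOpen Λ) (h0 : (0 : Matrix (Fin n) (Fin n) (LocalRing E v)) ∈ Λ)
    {N₀ N₁ : Subgroup (UnitaryGroup.localPi E c (n + n) JD v)}
    (hN₁ : ∀ u, u ∈ N₁ ↔ u ∈ unipDeltaLocal F E c v n (JD := JD) ∧ blkB (matA F E c v n u) ∈ Λ) [Fintype (N₁ ⧸ N₀.subgroupOf N₁)]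
    {f₀ : UnitaryGroup.localPi E c (n + n) JD v → ℂ} (hf₀U : f₀ ∈ U)
    (hf₀ : ∀ p, IsSiegelDelta F E c hcδ hδ hd v n hT₀ hJD p → ∀ h, f₀ (p * h) = χ p * f₀ h)
    (hf₀off : ∀ h, (¬ ∃ p, IsSiegelDelta F E c hcδ hδ hd v n hT₀ hJD p ∧ ∃ u ∈ unipDeltaLocal F E c v n (JD := JD), h = p * weylDelta F E c v n hJD * u) →
      f₀ h = 0)
    (hf₀inv : ∀ h, ∀ u ∈ N₀, f₀ (h * u) = f₀ h)
    (hf₀out : ∀ u ∈ unipDeltaLocal F E c v n (JD := JD), u ∉ N₁ → f₀ (weylDelta F E c v n hJD * u) = 0)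
    (hsum : ∑ q : N₁ ⧸ N₀.subgroupOf N₁, f₀ (weylDelta F E c v n hJD * (q.out : UnitaryGroup.localPi E c (n + n) JD v)) ≠ 0)
    (f : UnitaryGroup.localPi E c (n + n) JD v → ℂ) (hf : ∀ p, IsSiegelDelta F E c hcδ hδ hd v n hT₀ hJD p → ∀ h, f (p * h) = χ p * f h)
    (hfs : ∃ V : Subgroup (UnitaryGroup.localPi E c (n + n) JD v), IsOpen (V : Set (UnitaryGroup.localPi E c (n + n) JD v)) ∧ ∀ h, ∀ u ∈ V, f (h * u) = f h) :
    f ∈ U := by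
  -- `P_Δ(F_v)` as a subgroup
  let P : Subgroup (UnitaryGroup.localPi E c (n + n) JD v) :=
    { carrier := {p | IsSiegelDelta F E c hcδ hδ hd v n hT₀ hJD p}
      mul_mem' := fun hp hq => hp.mul hq
      one_mem' := isSiegelDelta_one F E c hcδ hδ hd v n hT₀ hJD
      inv_mem' := fun hp => hp.inv }
  have hcell : {h : UnitaryGroup.localPi E c (n + n) JD v | ∃ p ∈ P, ∃ u ∈ unipDeltaLocal F E c v n (JD := JD), h = p * weylDelta F E c v n hJD * u} =
      {h | ∃ p, IsSiegelDelta F E c hcδ hδ hd v n hT₀ hJD p ∧ ∃ u ∈ unipDeltaLocal F E c v n (JD := JD), h = p * weylDelta F E c v n hJD * u} := rfl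
  -- the group geometry, by value
  obtain ⟨K₀, hK₀, hIw⟩ := exists_isCompact_isSiegelDelta_mul F E c hcδ hδ hd v n hT₀ hJD hT₀d
  obtain ⟨ν, hνc, hν⟩ := exists_bigCell_coordinate F E c hcδ hδ hd v n hT₀ hT₀d hJD
  have hΩ := isOpen_bigCell F E c hcδ hδ hd v n hT₀ hT₀d hJD
  refine spanning_criterion (P := P) (N := unipDeltaLocal F E c v n (JD := JD)) (N₀ := N₀) (N₁ := N₁)
    (unipDeltaLocal_comm F E c v n (JD := JD)) (fun u hu => ((hN₁ u).1 hu).1) (fun p hp => hχ p hp) hK₀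
    (fun g => ?_) (w := weylDelta F E c v n hJD) (by rw [hcell]; exact hΩ) (ν := ν) (by rw [hcell]; exact hνc) (fun p hp u hu => hν p hp u hu)
    (fun V hV => ?_) U hU hf₀U (fun p hp h => hf₀ p hp h) (fun h hh => hf₀off h hh) hf₀inv hf₀out hsum f
    (fun p hp h => hf p hp h) hfs
  · obtain ⟨p, hp, k, hk, hgk⟩ := hIw g
    exact ⟨p, hp, k, hk, hgk⟩
  · obtain ⟨m, pm, hpm, hwm, h1, h2, h3, h4⟩ := exists_contracting F E c hcδ hδ hd v n hT₀ hJD hΛc hΛo h0 hN₁ V hV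
    exact ⟨m, pm, hpm, hwm, h1, h2, h3, h4⟩

include hT₀d in
/-- **`I_v(s, χ_v) ≤ U` FROM A WITNESS.**  ★ `mem_of_witness` for the inducing character `χ_v(det_Δ)|det_Δ|_v^{s+n/2}` (★ `localSiegelCharacter`, assumed non-vanishing on
`P_Δ` — at the K2Liu CM datum this is ★ `localSiegelCharacter_ne_zero`): the degenerate principal series ★ `localDegPS χ_v s` (smooth Siegel sections) is contained in any
right-invariant `U` carrying a witness. [cite: Kudla1994, §3] [cite: HarrisKudlaSweet1996, §1 (1.11), (1.15)] [cite: KudlaSweet1997, §1] -/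
theorem localDegPS_le_of_witness [NonarchimedeanGroup (UnitaryGroup.localPi E c (n + n) JD v)]
    (χv : ∀ w : UnitaryGroup.PlacesOver E v, (w.1.adicCompletion E)ˣ →* ℂˣ) (s : ℂ)
    (hχ : ∀ p, IsSiegelDelta F E c hcδ hδ hd v n hT₀ hJD p → localSiegelCharacter F E c v n χv s p ≠ 0)
    (U : Submodule ℂ (UnitaryGroup.localPi E c (n + n) JD v → ℂ)) (hU : ∀ G ∈ U, ∀ g : UnitaryGroup.localPi E c (n + n) JD v, (fun h => G (h * g)) ∈ U)
    {Λ : Set (Matrix (Fin n) (Fin n) (LocalRing E v))} (hΛc : IsCompact Λ) (hΛo : IsOpen Λ) (h0 : (0 : Matrix (Fin n) (Fin n) (LocalRing E v)) ∈ Λ)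
    {N₀ N₁ : Subgroup (UnitaryGroup.localPi E c (n + n) JD v)}
    (hN₁ : ∀ u, u ∈ N₁ ↔ u ∈ unipDeltaLocal F E c v n (JD := JD) ∧ blkB (matA F E c v n u) ∈ Λ) [Fintype (N₁ ⧸ N₀.subgroupOf N₁)]
    {f₀ : UnitaryGroup.localPi E c (n + n) JD v → ℂ} (hf₀U : f₀ ∈ U)
    (hf₀ : IsLocalSiegelSection F E c hcδ hδ hd v n hT₀ hJD χv s f₀)
    (hf₀off : ∀ h, (¬ ∃ p, IsSiegelDelta F E c hcδ hδ hd v n hT₀ hJD p ∧ ∃ u ∈ unipDeltaLocal F E c v n (JD := JD), h = p * weylDelta F E c v n hJD * u) →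
      f₀ h = 0)
    (hf₀inv : ∀ h, ∀ u ∈ N₀, f₀ (h * u) = f₀ h)
    (hf₀out : ∀ u ∈ unipDeltaLocal F E c v n (JD := JD), u ∉ N₁ → f₀ (weylDelta F E c v n hJD * u) = 0)
    (hsum : ∑ q : N₁ ⧸ N₀.subgroupOf N₁, f₀ (weylDelta F E c v n hJD * (q.out : UnitaryGroup.localPi E c (n + n) JD v)) ≠ 0) :
    localDegPS F E c hcδ hδ hd v n hT₀ hJD χv s ≤ U := by
  intro f hf
  rw [mem_localDegPS_iff] at hf
  obtain ⟨hlaw, ⟨V, hV⟩⟩ := hf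
  exact mem_of_witness F E c hcδ hδ hd v n hT₀ hT₀d hJD hχ U hU hΛc hΛo h0 hN₁ hf₀U (fun p hp h => hf₀ p hp h) hf₀off hf₀inv hf₀out hsum f
    (fun p hp h => hlaw p hp h) ⟨V, V.isOpen, fun h u hu => hV h u hu⟩

end Summit.HodgeConjecture.HodgeConjecture.Cruxes.HLiu418.K2LiuLocalSWSpanningOfWitness

end
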